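import Summits.BirchSwinnertonDyer.BirchSwinnertonDyer.Theorems.SchneiderFreeAdditiveX3PoitouTateMuUnramifiedCharacterClasses
import Summits.BirchSwinnertonDyer.BirchSwinnertonDyer.Theorems.Rank1ResidualJetSignedGlobalDualityPlus
import Literature.NumberTheory.GaloisCohomology.CyclicClassLocalArtinSymbol
import Literature.NumberTheory.GaloisCohomology.KummerClassLocalSurjective
import Literature.NumberTheory.GaloisCohomology.ArchimedeanInvariantMap
import Literature.NumberTheory.NumberFields.IdeleClassFieldCharacterSeparationFaithful
import Literature.NumberTheory.GaloisRepresentations.CyclicCharacterOfFaithfulCharacter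
import HarnessLib

/-!
# Poitou–Tate toolkit (μₚ-case, 2/·): Milne *ADT* I Thm. 4.10(b) `Ker γ¹ ⊆ Im β¹` for `M = μₚ`
# over a totally complex number field, MODULO the unramifiedness of Kummer classes of local units

Seat `bsd-schneider-door-c6`, gen 6 (cell `bsd-schneider-ideate`; crux `AnticycControlAdditiveK`,
stmt-BirchSwinnertonDyer-19295).  THEOREMS ONLY.  HONEST FRAMING: a CONDITIONAL reduction; proves no case
of BSD.  It assembles the `μₚ`-case (prime level `p`, `K` totally complex) of the hypothesis `hE` of
`exists_localInvariants_duality_of_middleExact_canonical` (door-c6 gen 5, p484492) — Milne *ADT* I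
Thm. 4.10(b), inclusion `Ker γ¹ ⊆ Im β¹`, for THE invariant maps and the module `μₚ` — from this gen's
tree theorems:

* the Kummer half `exists_forall_localization_δ₀_eq` (p495837): the local classes `t_v`, `v ∈ S` finite,
  are `loc_v κₚ(b)` for one `b ∈ Kˣ`;
* the local symbols `localInvariantMap_localization_cupProduct_δ₀_eq_neg_apply` (p493213): the local Tate
  pairing of `loc_v κₚ(b)` with `loc_v [ψ]` is `-ψ(res_v w_b)`, i.e. `log_ζ χ(ψ_{L|K}⟨b⟩_v)⁻¹`;
* the class-field half `exists_eq_principalIdele_mul_mul_pow_of_forall_faithful_character` (p496454):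
  the idèle `ξ = ∏_{v ∈ S} ⟨b⟩_v`, killed by every faithful class-field character of exponent `p`
  unramified outside `S` (this is what the orthogonality hypothesis of `hE` says, via
  `exists_cyclicCharacter_of_injective` (p496927) and the unramifiedness of `[ψ]` off `S`,
  `localization_oneCocycleClass_scalarCocycle_mem_unramifiedSubgroup_of_forall_localUnits`), is
  `(a) · u · yᵖ` with `u ∈ U_K^S`;
* so `x = κₚ(a)` has `loc_v x = t_v` on `S` and is, at a finite `w ∉ S`, the Kummer class of an element
  of `𝒪_wˣ · (K_wˣ)ᵖ`.

The ONE input kept as a hypothesis (`hKU`, NOT in the tree in the Poitou–Tate dialect; Neukirch, *Class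
Field Theory* III (7.7) proof / Silverman AEC VIII.1.6: «`K_w(a^{1/p})/K_w` is unramified iff
`ord_w(a) ≡ 0 (mod p)`», `w ∤ p`): the localisation at `w ∤ p` of the Kummer class of an `a ∈ Kˣ` lying
in `𝒪_wˣ · (K_wˣ)ᵖ` belongs to `unramifiedSubgroup`.  With it, `middleExact_mu_of_kummerUnramified` is
exactly the `μₚ`-instance of `hE`.

References: [MilneADT2006] I Thm. 4.10(b), I §2; [CasselsFrohlichANT1967] VII §5.1, §10–§11;
[SerreLocalFields1979] XIV §1; [NeukirchANT1999] VI (5.6)–(6.1).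
-/

noncomputable section

open CategoryTheory Function NumberField IsDedekindDomain Field ValuativeRel
open scoped NumberField

set_option linter.dupNamespace false

namespace Summit.BirchSwinnertonDyer.BirchSwinnertonDyer.Theorems.SchneiderFreeAdditiveX3.PoitouTateReduction

open _root_.ContinuousCohomology
open Literature.NumberTheory.GaloisRepresentations
open Literature.NumberTheory.GaloisRepresentations.DiscreteGaloisModule
open Literature.NumberTheory.GaloisRepresentations.IsNonarchimedeanLocalField
open Literature.NumberTheory.GaloisCohomology
open Literature.NumberTheory.NumberFields
open Literature.AnabelianGeometry.AbsoluteAnabelian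
open Literature.AnabelianGeometry.AbsoluteAnabelian.Prop121vii
open Summit.BirchSwinnertonDyer.Rank1Residual.X11b
open Summit.BirchSwinnertonDyer.Rank1Residual.JET.GlobalDuality

variable {K : Type} [Field K] [NumberField K] {p : ℕ} [hp : Fact p.Prime]

/-- **Two elements of `Kˣ` congruent modulo `(K_vˣ)ᵖ` have the same local Kummer class**
(`loc_v κₚ(a) = loc_v κₚ(b)` when `b = a · cᵖ` in `K_v`). [cite: SerreLocalFields1979, X §3] -/
theorem localization_δ₀_eq_of_eq_mul_pow (v : HeightOneSpectrum (𝓞 K)) (a b : K) (ha : a ≠ 0) (hb : b ≠ 0)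
    {c : v.adicCompletion K} (hc : c ≠ 0)
    (h : algebraMap K (v.adicCompletion K) b = algebraMap K (v.adicCompletion K) a * c ^ p) :
    galoisCohomology.localization (mu K p) (Sum.inr v) 1
        ((isSES_kummer K p hp.out.pos).δ₀ (baseUnitsInvariant K b hb)) =
      galoisCohomology.localization (mu K p) (Sum.inr v) 1
        ((isSES_kummer K p hp.out.pos).δ₀ (baseUnitsInvariant K a ha)) := by
  haveI : NeZero p := ⟨hp.out.ne_zero⟩
  obtain ⟨x, hx, hxt⟩ := exists_cohomologyMap_muLocalIso_eq_δ₀ v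
    (galoisCohomology.localization (mu K p) (Sum.inr v) 1
      ((isSES_kummer K p (NeZero.pos p)).δ₀ (baseUnitsInvariant K a ha)))
  -- `x ≡ a (mod p-th powers)`: indeed the transported class of `a` is `κ(a_v)`
  have ha' : algebraMap K (v.adicCompletion K) a ≠ 0 := (map_ne_zero_iff _ (algebraMap K _).injective).2 ha
  have hkey : (cohomologyMap (muLocalIso v p).hom 1).hom
      (galoisCohomology.localization (mu K p) (Sum.inr v) 1
        ((isSES_kummer K p (NeZero.pos p)).δ₀ (baseUnitsInvariant K a ha))) =
      (isSES_kummer (v.adicCompletion K) p (NeZero.pos p)).δ₀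
        (baseUnitsInvariant (v.adicCompletion K) (algebraMap K (v.adicCompletion K) a) ha') := by
    rw [cohomologyMap_muLocalIso_localization, resMu_δ₀_baseUnitsInvariant K (v.adicCompletion K) a ha ha']
  exact localization_δ₀_baseUnitsInvariant_eq_of_eq_mul_pow v _ ha' hkey b hb hc h

/-- **Milne *ADT* I Thm. 4.10(b) `Ker γ¹ ⊆ Im β¹` for `M = μₚ` over a totally complex number field,
modulo the unramifiedness of Kummer classes of local units** (`hKU`).  In the shape of the hypothesis
`hE` of `exists_localInvariants_duality_of_middleExact_canonical` specialised to `ρ = mu K p`: for a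
finite set `S` of places containing the infinite ones, with `p ∉ w` for the finite `w ∉ S`, every family
of local classes `t_v ∈ H¹(K_v, μₚ)` which is orthogonal, under the sum over `S` of the local Tate
pairings of THE invariant maps, to every class of `H¹(K, μₚ^D)` unramified outside `S`, is the
localisation on `S` of a global class `x ∈ H¹(K, μₚ)` unramified outside `S`.
[cite: MilneADT2006, Ch. I, Thm. 4.10(b)] [cite: CasselsFrohlichANT1967, Ch. VII §5.1 Main Theorem (B), (D)] -/
theorem middleExact_mu_of_kummerUnramified (hK : ∀ w : InfinitePlace K, w.IsComplex)
    (hKU : ∀ (w : HeightOneSpectrum (𝓞 K)) (a : K) (ha : a ≠ 0), ((p : ℕ) : 𝓞 K) ∉ w.asIdeal →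
      (∃ (u : (w.adicCompletion K)ˣ) (c : w.adicCompletion K), Valued.v (u : w.adicCompletion K) = 1 ∧
        algebraMap K (w.adicCompletion K) a = u * c ^ p) →
      galoisCohomology.localization (mu K p) (Sum.inr w) 1
        ((isSES_kummer K p hp.out.pos).δ₀ (baseUnitsInvariant K a ha)) ∈
          unramifiedSubgroup (GaloisRep.toLocal w (mu K p)) 1)
    (S : Finset (Place K)) (_hinf : ∀ w : InfinitePlace K, (Sum.inl w : Place K) ∈ S)
    (hS : ∀ v : HeightOneSpectrum (𝓞 K), (Sum.inr v : Place K) ∉ S →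
      ((p : ℕ) : 𝓞 K) ∉ v.asIdeal ∧ GaloisRep.IsUnramifiedAt v (mu K p))
    (t : Π v : Place K, galoisCohomology ((mu K p).toLocal v) 1)
    (horth : ∀ y : galoisCohomology ((mu K p).tateDual p) 1,
      (∀ v : HeightOneSpectrum (𝓞 K), (Sum.inr v : Place K) ∉ S →
        galoisCohomology.localization ((mu K p).tateDual p) (Sum.inr v) 1 y ∈
          unramifiedSubgroup (GaloisRep.toLocal v ((mu K p).tateDual p)) 1) →
      ∑ v ∈ S, localTatePairingZMod (mu K p) p v (LocalInvariants.canonical K p v) (t v)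
        (galoisCohomology.localization ((mu K p).tateDual p) v 1 y) = 0) :
    ∃ x : galoisCohomology (mu K p) 1,
      (∀ v : HeightOneSpectrum (𝓞 K), (Sum.inr v : Place K) ∉ S →
        galoisCohomology.localization (mu K p) (Sum.inr v) 1 x ∈
          unramifiedSubgroup (GaloisRep.toLocal v (mu K p)) 1) ∧
      ∀ v ∈ S, galoisCohomology.localization (mu K p) v 1 x = t v := by
  classical
  haveI : NeZero p := ⟨hp.out.ne_zero⟩
  haveI : CompactSpace (absoluteGaloisGroup K) := absoluteGaloisGroup_compactSpace K
  haveI : Finite (MuCarrier K p) := Literature.NumberTheory.GaloisRepresentations.finite_muCarrier K p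
  set hR := artinReciprocity_character_holds
  -- the finite places of `S`
  set Sf : Finset (HeightOneSpectrum (𝓞 K)) := S.toRight with hSf
  have hmemSf : ∀ v, v ∈ Sf ↔ (Sum.inr v : Place K) ∈ S := fun v => by rw [hSf, Finset.mem_toRight]
  -- §1. Kummer half: `t_v = loc_v κ(b)` on the finite part of `S`
  obtain ⟨b, hb0, -, hbt⟩ := exists_forall_localization_δ₀_eq (n := p) Sf fun v => t (Sum.inr v)
  set bu : Kˣ := Units.mk0 b hb0 with hbu
  have hκb : (isSES_kummer K p (NeZero.pos p)).δ₀ (baseUnitsInvariant K (bu : K) bu.ne_zero) =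
      (isSES_kummer K p (NeZero.pos p)).δ₀ (baseUnitsInvariant K b hb0) := rfl
  -- §2. the idèle `ξ = ∏_{v ∈ Sf} ⟨b⟩_v`
  set ξ : ideleGroup K := ∏ v ∈ Sf, localUnits v (globalToLocalUnits v bu) with hξ
  have hξsnd : ∀ v, (ξ : AdeleRing (𝓞 K) K).2 v =
      if v ∈ Sf then algebraMap K (v.adicCompletion K) b else 1 := by
    intro v
    rw [hξ, snd_prod_localUnits]
    split_ifs <;> simp [val_globalToLocalUnits, hbu]
  -- Weil-group lifts of `b` at the finite places
  have hlift : ∀ v : HeightOneSpectrum (𝓞 K), ∃ w : WeilGroup (v.adicCompletion K),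
      canonicalArtin (v.adicCompletion K) w = globalToLocalUnits v bu := fun v =>
    (isLocalArtinMap_canonicalArtin_holds (v.adicCompletion K)).isOpenQuotientMap_artin.surjective _
  choose wv hwv using hlift
  -- §3. class-field half: `ξ` is killed by every faithful character of exponent `p` unramified off `Sf`
  have hsep := exists_eq_principalIdele_mul_mul_pow_of_forall_faithful_character (n := p) Sf ξ
    fun L _ _ _ χ hinj hχp hunr => ?goal
  case goal =>
    -- local units at `v ∉ Sf` are killed by `ψ_{L|K}` (faithfulness of `χ`)
    have hunits : ∀ v : HeightOneSpectrum (𝓞 K), v ∉ Sf → ∀ u : (v.adicCompletion K)ˣ,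
        Valued.v (u : v.adicCompletion K) = 1 → artinIdeleMap L hR (localUnits v u) = 1 :=
      fun v hv u hu => hinj (by rw [map_one]; exact hunr v hv u hu)
    -- the cyclic character of `χ`
    obtain ⟨d, hdne, ζ, ψ, hζ, hker, hval, hdvd⟩ := exists_cyclicCharacter_of_injective L χ hinj
    have hd : d = 1 ∨ d = p := (Nat.dvd_prime hp.out).mp (hdvd p hχp)
    -- `χ(ψ_{L|K} ξ) = ∏_{v ∈ Sf} χ(r_L(res_v w_v))⁻¹ = (∏ ζ ^ (ψ(res_v w_v)).val)⁻¹`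
    have hχξ : χ (artinIdeleMap L hR ξ) =
        (∏ v ∈ Sf, ζ ^ (ψ (absGaloisRestrict K (v.adicCompletion K)
          (WeilGroup.toAbsGalois (v.adicCompletion K) (wv v)))).val)⁻¹ := by
      rw [← MonoidHom.comp_apply, hξ, map_prod, ← Finset.prod_inv_distrib]
      refine Finset.prod_congr rfl fun v _ => ?_
      rw [MonoidHom.comp_apply, ← hwv v, artinIdeleMap_localUnits_canonicalArtin_eq_inv L (wv v), map_inv,
        hval]
    rcases hd with hd1 | hdp
    · -- `d = 1`: `ψ` is trivial, so every factor is `ζ ^ 0`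
      subst hd1
      rw [hχξ, inv_eq_one]
      refine Finset.prod_eq_one fun v _ => ?_
      rw [show (ψ (absGaloisRestrict K (v.adicCompletion K)
        (WeilGroup.toAbsGalois (v.adicCompletion K) (wv v)))).val = 0 from by
          rw [Subsingleton.elim (ψ _) 0, ZMod.val_zero], pow_zero]
    · subst d
      -- the class `y = [ψ]` is unramified outside `S`
      set y : galoisCohomology ((mu K p).tateDual p) 1 := oneCocycleClass _ (scalarCocycle ψ) with hy
      have hyur : ∀ v : HeightOneSpectrum (𝓞 K), (Sum.inr v : Place K) ∉ S →
          galoisCohomology.localization ((mu K p).tateDual p) (Sum.inr v) 1 y ∈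
            unramifiedSubgroup (GaloisRep.toLocal v ((mu K p).tateDual p)) 1 := fun v hv =>
        localization_oneCocycleClass_scalarCocycle_mem_unramifiedSubgroup_of_forall_localUnits
          L ψ hker v (hunits v fun h => hv ((hmemSf v).mp h))
      have hsum := horth y hyur
      -- the archimedean terms vanish (`K` totally complex): the sum is over `Sf`
      have hsub : Sf.map ⟨Sum.inr, Sum.inr_injective⟩ ⊆ S := fun q hq => by
        obtain ⟨v, hv, rfl⟩ := Finset.mem_map.mp hq
        exact (hmemSf v).mp hv
      rw [← Finset.sum_subset hsub (fun q hq hq' => ?_), Finset.sum_map] at hsum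
      swap
      · rcases q with w | v
        · rw [localTatePairingZMod_apply, LocalInvariants.canonical_inl_eq_zero_of_isComplex (hK w)]
        · exact absurd (Finset.mem_map.mpr ⟨v, (hmemSf v).mpr hq, rfl⟩) hq'
      simp only [Function.Embedding.coeFn_mk] at hsum
      -- each finite term is `-ψ(res_v w_v)` (Serre XIV §1 Prop. 3, this gen's theorem)
      have hterm : ∀ v ∈ Sf, localTatePairingZMod (mu K p) p (Sum.inr v)
          (LocalInvariants.canonical K p (Sum.inr v)) (t (Sum.inr v))
          (galoisCohomology.localization ((mu K p).tateDual p) (Sum.inr v) 1 y) =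
          -ψ (absGaloisRestrict K (v.adicCompletion K) (WeilGroup.toAbsGalois (v.adicCompletion K) (wv v))) := by
        intro v hv
        rw [← hbt v hv, ← hκb, localTatePairingZMod_apply, ← LocalInvariants.localization_cupProduct,
          LocalInvariants.canonical_inr, hy]
        exact localInvariantMap_localization_cupProduct_δ₀_eq_neg_apply L ψ hker bu v (wv v) (hwv v)
      rw [Finset.sum_congr rfl fun v hv => hterm v hv, Finset.sum_neg_distrib, neg_eq_zero] at hsum
      -- hence `∑ (ψ(res_v w_v)).val ≡ 0 (mod p)` and `χ(ψ_{L|K} ξ) = (ζ ^ (p · m))⁻¹ = 1`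
      have hdvd' : p ∣ ∑ v ∈ Sf, (ψ (absGaloisRestrict K (v.adicCompletion K)
          (WeilGroup.toAbsGalois (v.adicCompletion K) (wv v)))).val := by
        rw [← ZMod.natCast_eq_zero_iff, Nat.cast_sum]
        simpa only [ZMod.natCast_zmod_val] using hsum
      rw [hχξ, Finset.prod_pow_eq_pow_sum, (hζ.pow_eq_one_iff_dvd _).mpr hdvd', inv_one]
  -- §4. the global class `x = κ(a₀)`
  obtain ⟨a₀, u, yI, hu, hdec⟩ := hsep
  have hcomp : ∀ v : HeightOneSpectrum (𝓞 K), (ξ : AdeleRing (𝓞 K) K).2 v =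
      algebraMap K (v.adicCompletion K) (a₀ : K) * (u : AdeleRing (𝓞 K) K).2 v *
        ((yI : AdeleRing (𝓞 K) K).2 v) ^ p := by
    intro v
    have h := congrArg (fun z : ideleGroup K => ideleGroup.finComp v z) hdec
    simp only [map_mul, map_pow, ideleGroup.finComp_apply, principalIdele_snd] at h
    exact h
  refine ⟨(isSES_kummer K p hp.out.pos).δ₀ (baseUnitsInvariant K (a₀ : K) a₀.ne_zero), fun v hv => ?_,
    fun q hq => ?_⟩
  · -- unramified outside `S`: `a₀ ∈ 𝒪_vˣ · (K_vˣ)ᵖ` at `v ∉ Sf`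
    have hvSf : v ∉ Sf := fun h => hv ((hmemSf v).mp h)
    have h1 := hcomp v
    rw [hξsnd, if_neg hvSf] at h1
    have hu0 : (u : AdeleRing (𝓞 K) K).2 v ≠ 0 := ideleGroup_snd_ne_zero u v
    have hy0 : (yI : AdeleRing (𝓞 K) K).2 v ≠ 0 := ideleGroup_snd_ne_zero yI v
    refine hKU v (a₀ : K) a₀.ne_zero (hS v hv).1 ⟨(Units.mk0 _ hu0)⁻¹, ((yI : AdeleRing (𝓞 K) K).2 v)⁻¹, ?_, ?_⟩
    · rw [Units.val_inv_eq_inv_val, Units.val_mk0, map_inv₀, hu.2.2 v, inv_one]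
    · rw [Units.val_inv_eq_inv_val, Units.val_mk0, inv_pow]
      have h2 : algebraMap K (v.adicCompletion K) (a₀ : K) *
          ((u : AdeleRing (𝓞 K) K).2 v * ((yI : AdeleRing (𝓞 K) K).2 v) ^ p) = 1 := by
        rw [← mul_assoc]; exact h1.symm
      rw [eq_inv_of_mul_eq_one_left h2, mul_inv]
  · rcases q with w | v
    · -- complex places: everything vanishes
      rw [galoisCohomology_inl_eq_zero_of_isComplex (mu K p) (hK w) (t _)]
      exact galoisCohomology_inl_eq_zero_of_isComplex (mu K p) (hK w) _
    · -- finite places of `S`: `b = a₀ · yᵖ` in `K_v`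
      have hvSf : v ∈ Sf := (hmemSf v).mpr hq
      have h1 := hcomp v
      rw [hξsnd, if_pos hvSf, hu.2.1 v hvSf, mul_one] at h1
      rw [← hbt v hvSf]
      exact (localization_δ₀_eq_of_eq_mul_pow v (a₀ : K) b a₀.ne_zero hb0 (ideleGroup_snd_ne_zero yI v) h1).symm

end Summit.BirchSwinnertonDyer.BirchSwinnertonDyer.Theorems.SchneiderFreeAdditiveX3.PoitouTateReduction

end
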